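import Mathlib
import HarnessLib
import Summits.NavierStokesRegularity.NavierStokesRegularity.Theorems.PoloidalWindowDoorLrcModEntireJetCertPsatzElim

/-!
# Jet-certificate checker — transcript replay with NORMALISED INTERMEDIATE PRODUCTS (the variant for large / symbolic-tilt cells)

Cell pub-ns-dss, seat ns-crc-p1 gen 5 (Lean-certificate hand of `ns-wall-extremal`, arm C; PREREG-WALL-1 §C, CERT-FORMAT-C v0.2), 2026-08-28.
`--supports stmt-NavierStokesRegularity-19708` (instrument).  Generic; no Navier–Stokes content.  Same nodes, same semantics and the same soundness
statements as `…JetCertPsatzElim` (`etreeCheck`, `killCheck`) — the ONLY difference is inside the substitution: `QMvPoly.mul` concatenates cross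
products without combining like terms, so `powQ num k` carries `|num|^k` raw terms before the final normalisation; on the all-tilt cell T1′(3,2) (γ a
letter) this exhausted the farm's memory although the normalised polynomials never exceed a few hundred terms.  Here every intermediate product is
normalised (`mulN`, `powQN`, `substQN`), values unchanged (`ev_mulN`, `ev_powQN`, `ev_substQN`).  Data modules of heavy cells use `killCheckN`; the
conclusion is the same `Kills`.

* `mulN`, `powQN`, `pinProductN`, `substQN`, `substLawN`, `substSignN` (+ value lemmas); `etreeCheckN` + **`not_pointDatum_of_etreeCheckN`**; `killCheckN` + **`kills_of_killCheckN`**.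

WHAT THIS IS NOT: not a claim about Navier–Stokes, not a certificate. [folklore]
-/

noncomputable section

-- the summit and its single sub-problem share the name (CONVENTIONS §1), as in every Theorems file
set_option linter.dupNamespace false

namespace Summit.NavierStokesRegularity.NavierStokesRegularity.Theorems.PoloidalWindowDoorLrcModEntireJetCertPsatzElimN

open _root_.Topology _root_.Filter Set
open Literature.Analysis.ValidatedNumerics Literature.Analysis.ValidatedNumerics.QMvPoly
open Literature.Analysis.Calculus.MvPoly
open Summit.NavierStokesRegularity.NavierStokesRegularity.Theorems.PoloidalWindowDoorLrcModEntireJetCertDefs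
open Summit.NavierStokesRegularity.NavierStokesRegularity.Theorems.PoloidalWindowDoorLrcModEntireJetCertTree
open Summit.NavierStokesRegularity.NavierStokesRegularity.Theorems.PoloidalWindowDoorLrcModEntireJetCertFast2
open Summit.NavierStokesRegularity.NavierStokesRegularity.Theorems.PoloidalWindowDoorLrcModEntireJetCertGauge
open Summit.NavierStokesRegularity.NavierStokesRegularity.Theorems.PoloidalWindowDoorLrcModEntireJetCertPsatz
open Summit.NavierStokesRegularity.NavierStokesRegularity.Theorems.PoloidalWindowDoorLrcModEntireJetCertPsatzSubst
open Summit.NavierStokesRegularity.NavierStokesRegularity.Theorems.PoloidalWindowDoorLrcModEntireJetCertPsatzElim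

variable {n : ℕ}

/-! ### Normalised products and powers -/

/-- Product of term lists, combined and canonicalised. [folklore] -/
def mulN (p q : QMvPoly) : QMvPoly := normalizeS (trimQ (QMvPoly.mul p q))

/-- `ev (mulN p q) = ev p * ev q`. [folklore] -/
theorem ev_mulN (p q : QMvPoly) (z : EuclideanSpace ℝ (Fin n)) : ev n (mulN p q) z = ev n p z * ev n q z := by
  rw [mulN, ev_normalizeS, ev_trimQ, ev_mul]

/-- Powers by repeated normalised multiplication (`p⁰ = 1`). [folklore] -/
def powQN (p : QMvPoly) : ℕ → QMvPoly
  | 0 => QMvPoly.const 1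
  | k + 1 => mulN p (powQN p k)

/-- `ev (powQN p k) = (ev p)^k`. [folklore] -/
theorem ev_powQN (p : QMvPoly) (z : EuclideanSpace ℝ (Fin n)) : ∀ k : ℕ, ev n (powQN p k) z = (ev n p z) ^ k := by
  intro k
  induction k with
  | zero => simp [powQN, ev, QMvPoly.toMv_const, toFun_apply]
  | succ k ih => rw [powQN, ev_mulN, ih, pow_succ, mul_comm]

/-- The monomial `Πᵢ pinsᵢ ^ eᵢ` with normalised powers (a transcript without content division accumulates large exponents on the pins: raw powers
would have `2^e` terms for the pin `1 + g²`). [folklore] -/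
def pinProductN : List QMvPoly → List ℕ → QMvPoly
  | [], _ => QMvPoly.const 1
  | _ :: _, [] => QMvPoly.const 1
  | π :: ps, e :: es => mulN (powQN π e) (pinProductN ps es)

/-- `pinProductN` has the value of `pinProduct`. [folklore] -/
theorem ev_pinProductN (z : EuclideanSpace ℝ (Fin n)) : ∀ (pins : List QMvPoly) (es : List ℕ),
    ev n (pinProductN pins es) z = ev n (pinProduct pins es) z := by
  intro pins
  induction pins with
  | nil => intro es; simp [pinProductN, pinProduct]
  | cons π ps ih =>
    intro es
    cases es with
    | nil => simp [pinProductN, pinProduct]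
    | cons e es => rw [pinProductN, pinProduct, ev_mulN, ev_powQN, ev_mul, ev_powQ, ih]

/-- The substitution `X_i := num / c` cleared to `c^d`, with normalised intermediate products. [folklore] -/
def substQN (i : ℕ) (num c : QMvPoly) (d : ℕ) (p : QMvPoly) : QMvPoly :=
  (p.map fun t => mulN [(zeroAt t.1 i, t.2)] (mulN (powQN num (t.1.getD i 0)) (powQN c (d - t.1.getD i 0)))).flatten

/-- **SOUNDNESS OF THE NORMALISING SUBSTITUTION**: at a point with `c(z)·z_i = num(z)`, and when `d` bounds the `i`-degree, `(substQN p)(z) = c(z)^d · p(z)`. [folklore] -/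
theorem ev_substQN (z : EuclideanSpace ℝ (Fin n)) (i : Fin n) (num c : QMvPoly) (hz : ev n c z * z i = ev n num z) :
    ∀ (p : QMvPoly) (d : ℕ), (∀ t ∈ p, t.1.getD i 0 ≤ d) → ev n (substQN i num c d p) z = ev n c z ^ d * ev n p z := by
  intro p
  induction p with
  | nil => intro d _; simp [substQN]
  | cons t q ih =>
    intro d hd
    have hk : t.1.getD i 0 ≤ d := hd t (by simp)
    have hsplit : substQN i num c d (t :: q) =
        mulN [(zeroAt t.1 i, t.2)] (mulN (powQN num (t.1.getD i 0)) (powQN c (d - t.1.getD i 0))) ++ substQN i num c d q := by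
      simp [substQN]
    rw [hsplit, ev_append, ih d (fun u hu => hd u (by simp [hu])), show t :: q = [t] ++ q from rfl, ev_append, ev_mulN, ev_mulN,
      ev_powQN, ev_powQN, ev_single, ev_single, prod_pow_split z t.1 i]
    set k := t.1.getD i 0 with hk_def
    have hpow : ev n num z ^ k * ev n c z ^ (d - k) = ev n c z ^ d * z i ^ k := by
      rw [← hz, mul_pow, mul_assoc, mul_comm (z i ^ k), ← mul_assoc, ← pow_add, Nat.add_sub_cancel' hk]
    rw [mul_add]
    congr 1
    calc (t.2 : ℝ) * (∏ j : Fin n, z j ^ (zeroAt t.1 i).getD j 0) * (ev n num z ^ k * ev n c z ^ (d - k))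
        = (t.2 : ℝ) * (∏ j : Fin n, z j ^ (zeroAt t.1 i).getD j 0) * (ev n c z ^ d * z i ^ k) := by rw [hpow]
      _ = ev n c z ^ d * ((t.2 : ℝ) * ((∏ j : Fin n, z j ^ (zeroAt t.1 i).getD j 0) * z i ^ k)) := by ring

/-- The substitution applied to a LAW or PIN: cleared to its own `i`-degree, canonicalised, rescaled (a no-op when `X_i` is absent). [folklore] -/
def substLawN (i : ℕ) (num c : QMvPoly) (p : QMvPoly) : QMvPoly :=
  if degIn i p = 0 then p else scaleMonic (normalizeS (trimQ (substQN i num c (degIn i p) p)))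

/-- The substitution applied to a SIGN constraint: cleared to an EVEN power and rescaled by a positive rational, so the sign is kept. [folklore] -/
def substSignN (i : ℕ) (num c : QMvPoly) (p : QMvPoly) : QMvPoly :=
  if degIn i p = 0 then p else scaleAbsMonic (normalizeS (trimQ (substQN i num c (2 * ((degIn i p + 1) / 2)) p)))

/-- Laws stay laws under the substitution. [folklore] -/
theorem ev_substLawN_eq_zero (z : EuclideanSpace ℝ (Fin n)) (i : Fin n) (num c : QMvPoly) (hz : ev n c z * z i = ev n num z) {p : QMvPoly}
    (hp : ev n p z = 0) : ev n (substLawN i num c p) z = 0 := by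
  unfold substLawN
  split_ifs with hd
  · exact hp
  · obtain ⟨κ, -, hκ⟩ := ev_scaleMonic (normalizeS (trimQ (substQN i num c (degIn i p) p))) z
    rw [hκ, ev_normalizeS, ev_trimQ, ev_substQN z i num c hz p _ (le_degIn (i : ℕ) p), hp]; simp

/-- Pins stay pins under the substitution (the pivot coefficient being non-zero at the point). [folklore] -/
theorem ev_substLawN_ne_zero (z : EuclideanSpace ℝ (Fin n)) (i : Fin n) (num c : QMvPoly) (hz : ev n c z * z i = ev n num z)
    (hc : ev n c z ≠ 0) {p : QMvPoly} (hp : ev n p z ≠ 0) : ev n (substLawN i num c p) z ≠ 0 := by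
  unfold substLawN
  split_ifs with hd
  · exact hp
  · obtain ⟨κ, hκ0, hκ⟩ := ev_scaleMonic (normalizeS (trimQ (substQN i num c (degIn i p) p))) z
    rw [hκ, ev_normalizeS, ev_trimQ, ev_substQN z i num c hz p _ (le_degIn (i : ℕ) p)]
    exact mul_ne_zero (by exact_mod_cast hκ0) (mul_ne_zero (pow_ne_zero _ hc) hp)

/-- Sign constraints stay sign constraints under the substitution. [folklore] -/
theorem ev_substSignN_nonneg (z : EuclideanSpace ℝ (Fin n)) (i : Fin n) (num c : QMvPoly) (hz : ev n c z * z i = ev n num z) {p : QMvPoly}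
    (hp : 0 ≤ ev n p z) : 0 ≤ ev n (substSignN i num c p) z := by
  unfold substSignN
  split_ifs with hd
  · exact hp
  · obtain ⟨κ, hκ0, hκ⟩ := ev_scaleAbsMonic (normalizeS (trimQ (substQN i num c (2 * ((degIn i p + 1) / 2)) p))) z
    rw [hκ, ev_normalizeS, ev_trimQ, ev_substQN z i num c hz p _ (fun t ht => ?_), mul_comm 2, pow_mul]
    · exact mul_nonneg (by exact_mod_cast hκ0.le) (mul_nonneg (sq_nonneg _) hp)
    · have := le_degIn (i : ℕ) p t ht
      omega

/-! ### Transcript trees, normalising variant -/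

/-- **THE TRANSCRIPT CHECK, normalising variant** (Boolean, structural recursion on the tree). [folklore] -/
def etreeCheckN (n : ℕ) : List QMvPoly → List QMvPoly → List ℕ → List QMvPoly → ETree → Bool
  | hyps, pins, zs, nonneg, .leaf c => pointCheckP n hyps pins zs nonneg c
  | hyps, pins, zs, nonneg, .chunk comb T t =>
      polyEq T (idealComb hyps comb) && etreeCheckN n (hyps ++ [T]) pins zs nonneg t
  | hyps, pins, zs, nonneg, .split π nz z => etreeCheckN n hyps (pins ++ [π]) zs nonneg nz && etreeCheckN n (hyps ++ [π]) pins zs nonneg z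
  | hyps, pins, zs, nonneg, .elim k i κ pe t =>
      let L := hyps.getD k []
      let c := coeffIn i L
      let num := QMvPoly.smul (-1) (restIn i L)
      decide (i < n) && decide (κ ≠ 0) && decide (degIn i L ≤ 1) && polyEq c (QMvPoly.smul κ (pinProductN pins pe)) &&
        etreeCheckN n (hyps.map (substLawN i num c)) (pins.map (substLawN i num c)) zs (nonneg.map (substSignN i num c)) t
  | hyps, pins, zs, nonneg, .force k j κ pe e t =>
      decide (j < n) && decide (κ ≠ 0) && decide (1 ≤ e) &&
        polyEq (hyps.getD k []) (QMvPoly.smul κ (mulN (pinProductN pins pe) (powQN (QMvPoly.var n j) e))) &&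
        etreeCheckN n (hyps ++ [QMvPoly.var n j]) pins zs nonneg t

/-- **SOUNDNESS OF TRANSCRIPT TREES (normalising variant)**: a checked tree proves that the semi-algebraic set `{hyps = 0, pins ≠ 0, gauge = 0, nonneg ≥ 0}` has no real point. [folklore] -/
theorem not_pointDatum_of_etreeCheckN : ∀ (t : ETree) {hyps pins : List QMvPoly} {zs : List ℕ} {nonneg : List QMvPoly},
    etreeCheckN n hyps pins zs nonneg t = true → ¬ PointDatum n hyps pins zs nonneg := by
  intro t
  induction t with
  | leaf c => intro hyps pins zs nonneg h; exact not_pointDatum_of_pointCheckP h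
  | chunk comb T t ih =>
    intro hyps pins zs nonneg h hd
    simp only [etreeCheckN, Bool.and_eq_true] at h
    obtain ⟨z, hh, hp, hz, hq⟩ := hd
    refine ih h.2 ⟨z, ?_, hp, hz, hq⟩
    intro L hL
    rcases List.mem_append.1 hL with hL' | hL'
    · exact hh L hL'
    · rw [List.mem_singleton.1 hL', ev_eq_of_polyEq h.1 z, ev_idealComb_eq_zero z hyps hh]
  | split π nz zt ihnz ihz =>
    intro hyps pins zs nonneg h hd
    simp only [etreeCheckN, Bool.and_eq_true] at h
    obtain ⟨z, hh, hp, hz, hq⟩ := hd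
    by_cases hπ : ev n π z = 0
    · refine ihz h.2 ⟨z, ?_, hp, hz, hq⟩
      intro L hL
      rcases List.mem_append.1 hL with hL' | hL'
      · exact hh L hL'
      · rw [List.mem_singleton.1 hL']; exact hπ
    · refine ihnz h.1 ⟨z, hh, ?_, hz, hq⟩
      intro π' hπ'
      rcases List.mem_append.1 hπ' with h' | h'
      · exact hp π' h'
      · rw [List.mem_singleton.1 h']; exact hπ
  | elim k i κ pe t ih =>
    intro hyps pins zs nonneg h hd
    simp only [etreeCheckN, Bool.and_eq_true, decide_eq_true_eq] at h
    obtain ⟨⟨⟨⟨hi, hκ⟩, hdeg⟩, hc⟩, ht⟩ := h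
    obtain ⟨z, hh, hp, hz, hq⟩ := hd
    set L := hyps.getD k [] with hL
    set c := coeffIn i L with hc_def
    set num := QMvPoly.smul (-1) (restIn i L) with hnum
    -- the pivot coefficient does not vanish at z, and c(z)·z_i = num(z)
    have hcz : ev n c z ≠ 0 := by
      rw [ev_eq_of_polyEq hc z, ev_smul, ev_pinProductN]
      exact mul_ne_zero (by exact_mod_cast hκ) (ev_pinProduct_ne_zero z pins pe hp)
    have hLz : ev n L z = 0 := ev_getD_eq_zero hh k
    have hlin := ev_linear_split z ⟨i, hi⟩ L hdeg
    have hzi : ev n c z * z ⟨i, hi⟩ = ev n num z := by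
      rw [hnum, ev_smul]; push_cast
      have : z ⟨i, hi⟩ * ev n c z + ev n (restIn i L) z = 0 := by rw [← hLz, hlin]
      linarith
    refine ih ht ⟨z, ?_, ?_, hz, ?_⟩
    · intro L' hL'
      obtain ⟨P, hP, rfl⟩ := List.mem_map.1 hL'
      exact ev_substLawN_eq_zero z ⟨i, hi⟩ num c hzi (hh P hP)
    · intro π' hπ'
      obtain ⟨P, hP, rfl⟩ := List.mem_map.1 hπ'
      exact ev_substLawN_ne_zero z ⟨i, hi⟩ num c hzi hcz (hp P hP)
    · intro q' hq'
      obtain ⟨P, hP, rfl⟩ := List.mem_map.1 hq'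
      exact ev_substSignN_nonneg z ⟨i, hi⟩ num c hzi (hq P hP)
  | force k j κ pe e t ih =>
    intro hyps pins zs nonneg h hd
    simp only [etreeCheckN, Bool.and_eq_true, decide_eq_true_eq] at h
    obtain ⟨⟨⟨⟨hj, hκ⟩, he⟩, hform⟩, ht⟩ := h
    obtain ⟨z, hh, hp, hz, hq⟩ := hd
    have hLz : ev n (hyps.getD k []) z = 0 := ev_getD_eq_zero hh k
    rw [ev_eq_of_polyEq hform z, ev_smul, ev_mulN, ev_pinProductN, ev_powQN, ev_var z ⟨j, hj⟩] at hLz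
    have hzj : z ⟨j, hj⟩ = 0 := by
      have h1 : (κ : ℝ) ≠ 0 := by exact_mod_cast hκ
      have h2 := ev_pinProduct_ne_zero z pins pe hp
      have h3 : z ⟨j, hj⟩ ^ e = 0 := by
        rcases mul_eq_zero.1 hLz with h | h
        · exact absurd h h1
        · rcases mul_eq_zero.1 h with h' | h'
          · exact absurd h' h2
          · exact h'
      exact pow_eq_zero_iff (by omega) |>.1 h3
    refine ih ht ⟨z, ?_, hp, hz, hq⟩
    intro L hL
    rcases List.mem_append.1 hL with hL' | hL'
    · exact hh L hL'
    · rw [List.mem_singleton.1 hL', ev_var z ⟨j, hj⟩]; exact hzj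

/-! ### Kill check, normalising variant -/

/-- **THE KILL CHECK (normalising variant)** (Boolean): all `j ∈ J` are letters, and the transcript tree refutes the system with the extra pin `Σ_{j∈J} X_j²`. [folklore] -/
def killCheckN (n : ℕ) (hyps pins : List QMvPoly) (zs : List ℕ) (nonneg : List QMvPoly) (J : List ℕ) (t : ETree) : Bool :=
  (J.all fun j => decide (j < n)) && etreeCheckN n hyps (pins ++ [sumSq n J]) zs nonneg t

/-- **SOUNDNESS OF THE KILL CHECK (normalising variant)**: a checked transcript proves that every solution is untwisted. [folklore] -/
theorem kills_of_killCheckN {hyps pins : List QMvPoly} {zs : List ℕ} {nonneg : List QMvPoly} {J : List ℕ} {t : ETree}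
    (h : killCheckN n hyps pins zs nonneg J t = true) : Kills n hyps pins zs nonneg J := by
  simp only [killCheckN, Bool.and_eq_true, List.all_eq_true, decide_eq_true_eq] at h
  obtain ⟨-, ht⟩ := h
  intro z hh hp hz hq j hjJ hj
  by_contra hne
  refine not_pointDatum_of_etreeCheckN t ht ⟨z, hh, ?_, hz, hq⟩
  intro π hπ
  rcases List.mem_append.1 hπ with h' | h'
  · exact hp π h'
  · rw [List.mem_singleton.1 h', ev_sumSq]
    have hnn : ∀ x ∈ J.map (fun j => ev n (QMvPoly.var n j) z * ev n (QMvPoly.var n j) z), (0 : ℝ) ≤ x := by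
      intro x hx
      obtain ⟨j', -, rfl⟩ := List.mem_map.1 hx
      exact mul_self_nonneg _
    have hmem : ev n (QMvPoly.var n j) z * ev n (QMvPoly.var n j) z ∈
        J.map (fun j => ev n (QMvPoly.var n j) z * ev n (QMvPoly.var n j) z) := List.mem_map.2 ⟨j, hjJ, rfl⟩
    have hle := List.single_le_sum hnn _ hmem
    have hpos : 0 < ev n (QMvPoly.var n j) z * ev n (QMvPoly.var n j) z := by
      rw [ev_var z ⟨j, hj⟩]; exact mul_self_pos.2 hne
    exact ne_of_gt (lt_of_lt_of_le hpos hle)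

/-! ### Self-test (`decide +kernel`) -/

/-- The toy transcript of `…JetCertPsatzElim` replays identically in the normalising variant. [folklore] -/
theorem example_killCheckN :
    killCheckN 3 [[([1, 0, 0], (2 : ℚ)), ([0, 0, 0], (-1 : ℚ))], [([1, 2, 0], (1 : ℚ))], [([0, 0, 1], (2 : ℚ)), ([1, 0, 1], (-2 : ℚ)), ([0, 0, 1], (-1 : ℚ))]]
      [] [] [] [1]
      (.elim 0 0 2 [] (.force 1 1 1 [] 2 (.elim 3 1 1 [] (.leaf { steps := [], comb := [], e := [1], sos0 := [], sosG := [] })))) = true := by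
  decide +kernel

end Summit.NavierStokesRegularity.NavierStokesRegularity.Theorems.PoloidalWindowDoorLrcModEntireJetCertPsatzElimN

end
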